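import Summits.QuantumFields.BalabanUV.Beta.D1BFx.PackedColumnBlockPairTotalMass

/-!
# `BalabanUV.Beta.D1BFx.PackedColumnBlockTotalScales` — road «BF-x» for binder row D1, slot (K), the (M-b) currency ON THE SCALES: **THE SUPPLIER JUNCTION TO
# 17-M♭ — `PackedColumnBlockTotalMass.mass_blk_vertexOfK_G₀_le_of_blockTotal` RE-INDEXED ON ANY BLOCK SIZE `[NeZero N]` AND ON THE SCALES `N = Lc^k`, `k ≥ 1`,
# CONCLUDING CHARACTER FOR CHARACTER THE fm∕mf PACKED-ROW HYPOTHESES `hPs hPm` OF d1-leaf-01's `PackedRoadRowsMassFlat.jet_letters_mass_flat`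
# (`mP j k′ := 4·C_{G₀}·e^{κ′∕2}·Zl 4 (κ′∕8)·m̄S j k′`) FROM THE PER-SLOT SUPPORT ROWS `hSs` AND THE BLOCK-TOTAL LETTERS `hSB` ACROSS THE SCALES; + THE PAIR ANALOGUE
# (`PackedColumnBlockPairTotalMass` §4 at `[NeZero N]` and on the scales)** (UNCONDITIONAL; [folklore] re-indexing only)

HONEST DEPENDENCY (cell records, verbatim): «continuum YM on T⁴ ⇐ BetaPertH ∧ nine spine estimates (0/9 proved); BetaPertH ⇐ (D1) ∧ (D4) ∧
CAP+tail; G-an2-4 gates asym, D1 and NE2/3/4.»  HONEST FRAMING (cell contract, verbatim): «discharging `BetaPertH` makes Bałaban's UV stability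
UNCONDITIONAL — a real constructive-QFT result; it is NOT the continuum limit and NOT the Clay problem.»  THIS MODULE DISCHARGES NOTHING of the
wall: [folklore] re-indexing BY NAME of this lineage's `PackedColumnBlockTotalMass` §2 and `PackedColumnBlockPairTotalMass` §4 (the `obtain ⟨M, rfl⟩` device of d1-leaf-01's `PackedRoadRowsPow.road_jet_mass_at`,
its `rate_window`).  Every letter is a DISPLAYED hypothesis on an ARBITRARY family; nothing about Bałaban's (or an1's ∕ an3's) tables is asserted.  No definition,
no `def … : Prop`, nothing cited, 0 sorry.  NO (1.22) unit row is proved here.  0 root-level binders of row D1 discharged (hW ∕ hR-sockets ∕ hSX-socket ∕ D1Tel ∕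
D1Rep = 0); (J1)∕[W] OPEN; (K) NOT closed; NOT D1, NOT `BetaPertH`, NOT continuum, NOT Clay.

ABSOLUTE RULE (cell charter, verbatim): «No internally-minted statement may enter as a cited fact. Every hypothesis is either kernel-proved in
this package or a verbatim quotation of a PUBLISHED theorem with page reference. The manuscript(s) under audit are NOT citable for their own
disputed steps — they are the thing under adjudication; programme-internal (2001/route/tribunal) claims are never citable.»

WHY (d1-leaf-01 g27 INTENT-4 ∕ A-1 «17-M♭ INPUT SPLIT», journal; OWNER d1-p2 g22 ρ-g22-1 (b) ∕ W-3): the re-cut mass façade `PackedRoadRowsMassFlat` takes the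
fm∕mf rows of the road's packed first jet as HYPOTHESES `hPs hPm` in `road_jet_mass_at`'s OUTPUT shape on the RAW packed jet
`blk (vertexOfK (coDressKBmAt (toSite (r (Lc^k))) (Lc^k) (KInvStep 3 (Lc^k) 0)) (Lc^k) (S (Lc^k)) ρ y) j k′` at the rate `σP∕Lc^k`, for every `k ≥ 1` and every
off-diagonal block `j ≠ k′` — «gan24-leaf-05's block-total letters are the supplier side».  This file is that supply: §1 re-indexes
`mass_blk_vertexOfK_G₀_le_of_blockTotal` (stated at `n = m + 1`) on an arbitrary block size `N` with `[NeZero N]`; §2 instantiates it on the scales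
`N := Lc^k` under the rate window `0 ≤ σP ≤ κ′∕16` (`rate_window`) and returns the pair `hPs ∕ hPm` in leaf-01's binder shape (the premise `j ≠ k′` is
accepted and unused — the block-total currency bounds every block).  INPUTS on the scales: `hSs` = the per-slot support rows at rate `σP∕Lc^k` for all
four blocks (d1-leaf-01's `RawStencilSupportRows.hSs_raw_scales ∕ hSs_S0NAt_scales`, `σP ≤ δ₀∕4`) and `hSB` = the block-total letters
`Σ_{b ∈ box 4 (Lc^k)} (u-centred (σP∕Lc^k)-weighted mass of blk (S (Lc^k) κ (Lc^k•y′ + b)) j k′) ≤ (Lc^k)⁴·m̄S j k′` (the table author's count, k-free `m̄S`).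
`κ′ = kappa163 4 ∕ 4`, `C_{G₀} = (MG163 4·periodConst (kappa163 4) 3)·(1 + 8(1 + e^{κ′}))·e^{κ′}`, `mP j k′ := 4·C_{G₀}·e^{κ′∕2}·Zl 4 (κ′∕8)·m̄S j k′`.

CONTENT (all [folklore]).
* §1 **`mass_blk_vertexOfK_G₀_le_of_blockTotal_at (N) [NeZero N]`** — FILE 2 §2's packed-vertex row at any block size (root `r ∈ box 4 N`, rate `0 ≤ σ ≤ κ′∕(16N)`).
* §2 **`hP_of_blockTotal_scales`** — on the scales `Lc^k`, `k ≥ 1`: `(∀ k ≥ 1, ∀ ρ y j k′, j ≠ k′ → Summable …) ∧ (∀ k ≥ 1, ∀ ρ y j k′, j ≠ k′ → Σ' … ≤ mP j k′)` — the two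
  conjuncts ARE `jet_letters_mass_flat`'s `hPs` and `hPm` (pass `.1` and `.2`).
* §3 the PAIR analogue: **`mass_blk_vertex2OfK_G₀_le_of_blockPairTotal_at (N) [NeZero N]`** and **`mass_blk_vertex2OfK_G₀_le_of_blockPairTotal_scales`** (on `Lc^k`,
  `k ≥ 1`, coarse decay `θ` in block units, k-free `m̄B`) — the packed bi-vertex rows of `vertex2OfK (G₀^{bm} (r (Lc^k))) (Lc^k) (S₂ (Lc^k)) μ y ν y′` for the pair
  split of `table_letters_mass` (ρ-g22-1 (b) last clause; the consumer's binder shape adapts by `le_trans`).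
NOT HERE (honest): the letters `hSs hSB hTs hTB` themselves (support rows: d1-leaf-01; block totals: the table author's count); any (1.22) row.
Unit `b2b-balaban-gan24-formalise-leaf-05` (gen 57), G-an2-4 swarm leaf prover 05, road «BF-x» supplier; INTENT-4 (journal).
-/

noncomputable section

open Finset
open scoped BigOperators
open Literature.MathematicalPhysics.QuantumFieldTheory.Balaban1983to89
open Literature.MathematicalPhysics.QuantumFieldTheory.Balaban1983to89.Beta
open B12Sec2to5 (l1 l1_nonneg)
open B5Hk163Strip (kappa163 kappa163_pos)
open B5Hk163Decay (MG163)
open B4TorusKernel (periodConst)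
open ExpKernelCalculus (Site MKer Zl)
open AffineAveraging (box toSite)
open OneStepResolventKernel (Fib)
open OneStepKernelFamily (colH KInvStep vertexOfK)
open Summit.QuantumFields.BalabanUV.Beta.AxialDressingRooted (coDressKBmAt)
open Summit.QuantumFields.BalabanUV.Beta.D1BFx.PackedKernelSplit (blk)
open SecondOrderResponse (vertex2OfK)
open Summit.QuantumFields.BalabanUV.Beta.D1BFx.PackedColumnBlockTotalMass (mass_blk_vertexOfK_G₀_le_of_blockTotal)
open Summit.QuantumFields.BalabanUV.Beta.D1BFx.PackedColumnBlockPairTotalMass (mass_blk_vertex2OfK_G₀_le_of_blockPairTotal)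

namespace Summit.QuantumFields.BalabanUV.Beta.D1BFx.PackedColumnBlockTotalScales

/-! ## §1 Any block size `[NeZero N]` -/

/-- [folklore] **THE (M-b) PACKED-VERTEX ROW FROM BLOCK-TOTAL LETTERS AT ANY BLOCK SIZE `[NeZero N]`** — `PackedColumnBlockTotalMass.mass_blk_vertexOfK_G₀_le_of_blockTotal`
re-indexed on `N` (the pattern-matching device `N = M + 1` of `PackedRoadRowsPow.road_jet_mass_at`), so that it applies at `N := Lc^k` with no rewriting of the scale. -/
theorem mass_blk_vertexOfK_G₀_le_of_blockTotal_at (N : ℕ) [NeZero N] {r : Fin (3 + 1) → ℕ} (hr : r ∈ box (3 + 1) N)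
    {S : Fin (3 + 1) → (Fin (3 + 1) → ℤ) → MKer 4 (Fib 3)} {σ : ℝ} {mS : Bool → Bool → ℝ}
    (hσ0 : 0 ≤ σ) (hσ : σ ≤ kappa163 4 / 4 / (16 * ((N : ℕ) : ℝ)))
    (hSs : ∀ κ u j k, Summable fun p : Site 4 × Site 4 =>
      ∑ g, ∑ f, |blk (S κ u) j k p.1 p.2 g f| * Real.exp (σ * (l1 (p.1 - u) + l1 (p.2 - u))))
    (hSB : ∀ (κ : Fin (3 + 1)) (y' : Fin (3 + 1) → ℤ) (j k : Bool), ∑ b ∈ box (3 + 1) N,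
      (∑' p : Site 4 × Site 4, ∑ g, ∑ f, |blk (S κ (((N : ℕ) : ℤ) • y' + toSite b)) j k p.1 p.2 g f|
        * Real.exp (σ * (l1 (p.1 - (((N : ℕ) : ℤ) • y' + toSite b)) + l1 (p.2 - (((N : ℕ) : ℤ) • y' + toSite b)))))
      ≤ ((N : ℕ) : ℝ) ^ 4 * mS j k)
    (μ : Fin (3 + 1)) (y : Fin (3 + 1) → ℤ) (j k : Bool) :
    (Summable fun p : Site 4 × Site 4 => ∑ g, ∑ f,
        |blk (vertexOfK (coDressKBmAt (toSite r) N (KInvStep (d := 3) N 0)) N S μ y) j k p.1 p.2 g f|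
          * Real.exp (σ * (l1 (p.1 - ((N : ℕ) : ℤ) • y) + l1 (p.2 - ((N : ℕ) : ℤ) • y)))) ∧
      ∑' p : Site 4 × Site 4, ∑ g, ∑ f,
          |blk (vertexOfK (coDressKBmAt (toSite r) N (KInvStep (d := 3) N 0)) N S μ y) j k p.1 p.2 g f|
            * Real.exp (σ * (l1 (p.1 - ((N : ℕ) : ℤ) • y) + l1 (p.2 - ((N : ℕ) : ℤ) • y)))
        ≤ 4 * ((MG163 4 * periodConst (kappa163 4) 3) * (1 + 8 * (1 + Real.exp (kappa163 4 / 4))) * Real.exp (kappa163 4 / 4))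
            * Real.exp (kappa163 4 / 4 / 2) * Zl 4 (kappa163 4 / 4 / 8) * mS j k := by
  obtain ⟨M, rfl⟩ : ∃ M, N = M + 1 := ⟨N - 1, (Nat.succ_pred_eq_of_ne_zero (NeZero.ne N)).symm⟩
  exact mass_blk_vertexOfK_G₀_le_of_blockTotal M hr hσ0 hσ hSs hSB μ y j k

/-! ## §2 On the scales `N = Lc^k`, `k ≥ 1`, in `jet_letters_mass_flat`'s binder shape -/

/-- [folklore] **THE SUPPLIER JUNCTION TO 17-M♭**: for the road's per-scale in-block roots `r n` and first-stencil families `S n`, one rate `0 ≤ σP ≤ κ′∕16`, the per-slot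
SUPPORT rows `hSs` at rate `σP∕Lc^k` (all four blocks) and the BLOCK-TOTAL letters `hSB` with a k-free table `m̄S`, at every scale `k ≥ 1`: the pair of conclusions IS
`PackedRoadRowsMassFlat.jet_letters_mass_flat`'s `hPs` (first conjunct) and `hPm` (second conjunct) with `mP j k′ := 4·C_{G₀}·e^{κ′∕2}·Zl 4 (κ′∕8)·m̄S j k′` — the fm∕mf
packed rows of the RAW packed jet are DISCHARGED from the table author's block-total count (the premise `j ≠ k′` is accepted and not used). -/
theorem hP_of_blockTotal_scales {Lc : ℕ} [NeZero Lc] {r : ℕ → Fin (3 + 1) → ℕ} (hr : ∀ m : ℕ, r (m + 1) ∈ box (3 + 1) (m + 1))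
    {S : ℕ → Fin 4 → (Fin 4 → ℤ) → MKer 4 (Fib 3)} {σP : ℝ} (hσP0 : 0 ≤ σP) (hσPκ : σP ≤ kappa163 4 / 4 / 16) {mS : Bool → Bool → ℝ}
    (hSs : ∀ (k : ℕ), 1 ≤ k → ∀ (κ : Fin 4) (u : Fin 4 → ℤ) (j k' : Bool), Summable fun p : Site 4 × Site 4 =>
      ∑ g, ∑ f, |blk (S (Lc ^ k) κ u) j k' p.1 p.2 g f| * Real.exp (σP / ((Lc ^ k : ℕ) : ℝ) * (l1 (p.1 - u) + l1 (p.2 - u))))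
    (hSB : ∀ (k : ℕ), 1 ≤ k → ∀ (κ : Fin 4) (y' : Fin 4 → ℤ) (j k' : Bool), ∑ b ∈ box (3 + 1) (Lc ^ k),
      (∑' p : Site 4 × Site 4, ∑ g, ∑ f, |blk (S (Lc ^ k) κ (((Lc ^ k : ℕ) : ℤ) • y' + toSite b)) j k' p.1 p.2 g f|
        * Real.exp (σP / ((Lc ^ k : ℕ) : ℝ)
          * (l1 (p.1 - (((Lc ^ k : ℕ) : ℤ) • y' + toSite b)) + l1 (p.2 - (((Lc ^ k : ℕ) : ℤ) • y' + toSite b)))))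
      ≤ ((Lc ^ k : ℕ) : ℝ) ^ 4 * mS j k') :
    (∀ (k : ℕ), 1 ≤ k → ∀ (ρ : Fin 4) (y : Site 4) (j k' : Bool), j ≠ k' → Summable fun p : Site 4 × Site 4 => ∑ g, ∑ f,
      |blk (vertexOfK (coDressKBmAt (toSite (r (Lc ^ k))) (Lc ^ k) (KInvStep (d := 3) (Lc ^ k) 0)) (Lc ^ k) (S (Lc ^ k)) ρ y) j k' p.1 p.2 g f|
        * Real.exp (σP / ((Lc ^ k : ℕ) : ℝ) * (l1 (p.1 - ((Lc ^ k : ℕ) : ℤ) • y) + l1 (p.2 - ((Lc ^ k : ℕ) : ℤ) • y)))) ∧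
    (∀ (k : ℕ), 1 ≤ k → ∀ (ρ : Fin 4) (y : Site 4) (j k' : Bool), j ≠ k' → ∑' p : Site 4 × Site 4, ∑ g, ∑ f,
      |blk (vertexOfK (coDressKBmAt (toSite (r (Lc ^ k))) (Lc ^ k) (KInvStep (d := 3) (Lc ^ k) 0)) (Lc ^ k) (S (Lc ^ k)) ρ y) j k' p.1 p.2 g f|
        * Real.exp (σP / ((Lc ^ k : ℕ) : ℝ) * (l1 (p.1 - ((Lc ^ k : ℕ) : ℤ) • y) + l1 (p.2 - ((Lc ^ k : ℕ) : ℤ) • y)))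
      ≤ 4 * ((MG163 4 * periodConst (kappa163 4) 3) * (1 + 8 * (1 + Real.exp (kappa163 4 / 4))) * Real.exp (kappa163 4 / 4))
          * Real.exp (kappa163 4 / 4 / 2) * Zl 4 (kappa163 4 / 4 / 8) * mS j k') := by
  -- one scale at a time
  have hk : ∀ (k : ℕ), 1 ≤ k → ∀ (ρ : Fin 4) (y : Site 4) (j k' : Bool),
      (Summable fun p : Site 4 × Site 4 => ∑ g, ∑ f,
        |blk (vertexOfK (coDressKBmAt (toSite (r (Lc ^ k))) (Lc ^ k) (KInvStep (d := 3) (Lc ^ k) 0)) (Lc ^ k) (S (Lc ^ k)) ρ y) j k' p.1 p.2 g f|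
          * Real.exp (σP / ((Lc ^ k : ℕ) : ℝ) * (l1 (p.1 - ((Lc ^ k : ℕ) : ℤ) • y) + l1 (p.2 - ((Lc ^ k : ℕ) : ℤ) • y)))) ∧
      ∑' p : Site 4 × Site 4, ∑ g, ∑ f,
        |blk (vertexOfK (coDressKBmAt (toSite (r (Lc ^ k))) (Lc ^ k) (KInvStep (d := 3) (Lc ^ k) 0)) (Lc ^ k) (S (Lc ^ k)) ρ y) j k' p.1 p.2 g f|
          * Real.exp (σP / ((Lc ^ k : ℕ) : ℝ) * (l1 (p.1 - ((Lc ^ k : ℕ) : ℤ) • y) + l1 (p.2 - ((Lc ^ k : ℕ) : ℤ) • y)))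
        ≤ 4 * ((MG163 4 * periodConst (kappa163 4) 3) * (1 + 8 * (1 + Real.exp (kappa163 4 / 4))) * Real.exp (kappa163 4 / 4))
            * Real.exp (kappa163 4 / 4 / 2) * Zl 4 (kappa163 4 / 4 / 8) * mS j k' := by
    intro k hk ρ y j k'
    have hn0 : (0 : ℝ) < ((Lc ^ k : ℕ) : ℝ) := by
      exact_mod_cast Nat.pos_of_ne_zero (pow_ne_zero k (NeZero.ne Lc))
    have hrk : r (Lc ^ k) ∈ box (3 + 1) (Lc ^ k) := by
      have h := hr (Lc ^ k - 1)
      rwa [Nat.sub_add_cancel (Nat.one_le_pow _ _ (Nat.pos_of_ne_zero (NeZero.ne Lc)))] at h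
    -- the rate window `0 ≤ σP∕n ≤ κ′∕(16n)`
    have hσ0 : 0 ≤ σP / ((Lc ^ k : ℕ) : ℝ) := div_nonneg hσP0 hn0.le
    have hσ : σP / ((Lc ^ k : ℕ) : ℝ) ≤ kappa163 4 / 4 / (16 * ((Lc ^ k : ℕ) : ℝ)) := by
      rw [← div_div]
      exact div_le_div_of_nonneg_right hσPκ hn0.le
    exact mass_blk_vertexOfK_G₀_le_of_blockTotal_at (Lc ^ k) hrk hσ0 hσ (hSs k hk) (hSB k hk) ρ y j k'
  exact ⟨fun k hk1 ρ y j k' _ => (hk k hk1 ρ y j k').1, fun k hk1 ρ y j k' _ => (hk k hk1 ρ y j k').2⟩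


/-! ## §3 The pair analogue: packed bi-vertex rows from block-pair totals at any block size and on the scales -/

/-- [folklore] **THE (M-b) PACKED BI-VERTEX ROW FROM BLOCK-PAIR TOTALS AT ANY BLOCK SIZE `[NeZero N]`** — `PackedColumnBlockPairTotalMass.mass_blk_vertex2OfK_G₀_le_of_blockPairTotal`
re-indexed on `N`. -/
theorem mass_blk_vertex2OfK_G₀_le_of_blockPairTotal_at (N : ℕ) [NeZero N] {r : Fin (3 + 1) → ℕ} (hr : r ∈ box (3 + 1) N)
    {S₂ : Fin 4 → Site 4 → Fin 4 → Site 4 → MKer 4 (Fib 3)} {θ : ℝ} {mB : Bool → Bool → ℝ} (hθ : 0 < θ)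
    (hTs : ∀ κ u κ' u' j i, Summable fun p : Site 4 × Site 4 => ∑ g, ∑ f, |blk (S₂ κ u κ' u') j i p.1 p.2 g f|)
    (hTB : ∀ (κ κ' : Fin 4) (y₁ y₂ : Site 4) (j i : Bool), ∑ b ∈ box 4 N, ∑ b' ∈ box 4 N,
      (∑' p : Site 4 × Site 4, ∑ g, ∑ f,
        |blk (S₂ κ (((N : ℕ) : ℤ) • y₁ + toSite b) κ' (((N : ℕ) : ℤ) • y₂ + toSite b')) j i p.1 p.2 g f|)
        ≤ ((N : ℕ) : ℝ) ^ 8 * mB j i * Real.exp (-θ * l1 (y₂ - y₁)))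
    (μ : Fin 4) (y : Site 4) (ν : Fin 4) (y' : Site 4) (j i : Bool) :
    (Summable fun p : Site 4 × Site 4 => ∑ g, ∑ f,
        |blk (vertex2OfK (coDressKBmAt (toSite r) N (KInvStep (d := 3) N 0)) N S₂ μ y ν y') j i p.1 p.2 g f|) ∧
      ∑' p : Site 4 × Site 4, ∑ g, ∑ f,
          |blk (vertex2OfK (coDressKBmAt (toSite r) N (KInvStep (d := 3) N 0)) N S₂ μ y ν y') j i p.1 p.2 g f|
        ≤ 16 * ((MG163 4 * periodConst (kappa163 4) 3) * (1 + 8 * (1 + Real.exp (kappa163 4 / 4))) * Real.exp (kappa163 4 / 4)) ^ 2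
            * (Real.exp (kappa163 4 / 4) * Real.exp (kappa163 4 / 4)) * (Zl 4 (kappa163 4 / 4 / 8) * Zl 4 (θ / 2))
          * mB j i * Real.exp (-(min (kappa163 4 / 4 / 8) (θ / 2)) * l1 (y' - y)) := by
  obtain ⟨M, rfl⟩ : ∃ M, N = M + 1 := ⟨N - 1, (Nat.succ_pred_eq_of_ne_zero (NeZero.ne N)).symm⟩
  exact mass_blk_vertex2OfK_G₀_le_of_blockPairTotal M hr hθ hTs hTB μ y ν y' j i

/-- [folklore] **THE (M-b) PACKED BI-VERTEX ROWS ON THE SCALES `Lc^k`, `k ≥ 1`**: per-scale roots `r n`, pair families `S₂ n`, one coarse rate `0 < θ` (block units) and a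
k-free table `m̄B`: per-slot-pair summability `hTs` + block-pair totals `hTB ≤ (Lc^k)⁸·m̄B j i·e^{−θ|y₂−y₁|₁}` at every scale ⟹ every block of
`vertex2OfK (G₀^{bm} (r (Lc^k))) (Lc^k) (S₂ (Lc^k)) μ y ν y′` has summable plain mass `≤ 16·C_{G₀}²·e^{2κ′}·Zl 4 (κ′∕8)·Zl 4 (θ∕2)·m̄B j i·e^{−min (κ′∕8) (θ∕2)|y′−y|₁}` — the
packed table rows the pair split of `PackedRoadRowsMass.table_letters_mass` will take as hypotheses for the `cB • vh₂S` sector. -/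
theorem mass_blk_vertex2OfK_G₀_le_of_blockPairTotal_scales {Lc : ℕ} [NeZero Lc] {r : ℕ → Fin (3 + 1) → ℕ}
    (hr : ∀ m : ℕ, r (m + 1) ∈ box (3 + 1) (m + 1))
    {S₂ : ℕ → Fin 4 → Site 4 → Fin 4 → Site 4 → MKer 4 (Fib 3)} {θ : ℝ} {mB : Bool → Bool → ℝ} (hθ : 0 < θ)
    (hTs : ∀ (k : ℕ), 1 ≤ k → ∀ κ u κ' u' j i, Summable fun p : Site 4 × Site 4 =>
      ∑ g, ∑ f, |blk (S₂ (Lc ^ k) κ u κ' u') j i p.1 p.2 g f|)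
    (hTB : ∀ (k : ℕ), 1 ≤ k → ∀ (κ κ' : Fin 4) (y₁ y₂ : Site 4) (j i : Bool), ∑ b ∈ box 4 (Lc ^ k), ∑ b' ∈ box 4 (Lc ^ k),
      (∑' p : Site 4 × Site 4, ∑ g, ∑ f,
        |blk (S₂ (Lc ^ k) κ (((Lc ^ k : ℕ) : ℤ) • y₁ + toSite b) κ' (((Lc ^ k : ℕ) : ℤ) • y₂ + toSite b')) j i p.1 p.2 g f|)
        ≤ ((Lc ^ k : ℕ) : ℝ) ^ 8 * mB j i * Real.exp (-θ * l1 (y₂ - y₁))) :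
    ∀ (k : ℕ), 1 ≤ k → ∀ (μ : Fin 4) (y : Site 4) (ν : Fin 4) (y' : Site 4) (j i : Bool),
      (Summable fun p : Site 4 × Site 4 => ∑ g, ∑ f,
          |blk (vertex2OfK (coDressKBmAt (toSite (r (Lc ^ k))) (Lc ^ k) (KInvStep (d := 3) (Lc ^ k) 0)) (Lc ^ k) (S₂ (Lc ^ k)) μ y ν y')
            j i p.1 p.2 g f|) ∧
        ∑' p : Site 4 × Site 4, ∑ g, ∑ f,
            |blk (vertex2OfK (coDressKBmAt (toSite (r (Lc ^ k))) (Lc ^ k) (KInvStep (d := 3) (Lc ^ k) 0)) (Lc ^ k) (S₂ (Lc ^ k)) μ y ν y')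
              j i p.1 p.2 g f|
          ≤ 16 * ((MG163 4 * periodConst (kappa163 4) 3) * (1 + 8 * (1 + Real.exp (kappa163 4 / 4))) * Real.exp (kappa163 4 / 4)) ^ 2
              * (Real.exp (kappa163 4 / 4) * Real.exp (kappa163 4 / 4)) * (Zl 4 (kappa163 4 / 4 / 8) * Zl 4 (θ / 2))
            * mB j i * Real.exp (-(min (kappa163 4 / 4 / 8) (θ / 2)) * l1 (y' - y)) := by
  intro k hk μ y ν y' j i
  have hrk : r (Lc ^ k) ∈ box (3 + 1) (Lc ^ k) := by
    have h := hr (Lc ^ k - 1)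
    rwa [Nat.sub_add_cancel (Nat.one_le_pow _ _ (Nat.pos_of_ne_zero (NeZero.ne Lc)))] at h
  exact mass_blk_vertex2OfK_G₀_le_of_blockPairTotal_at (Lc ^ k) hrk hθ (hTs k hk) (hTB k hk) μ y ν y' j i

end Summit.QuantumFields.BalabanUV.Beta.D1BFx.PackedColumnBlockTotalScales

end
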